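import Summits.BirchSwinnertonDyer.BirchSwinnertonDyer.Theorems.GenusKolyvaginAtTwoShaCardDvdPowAtTwoRTShaFiniteAtTwoRat
import HarnessLib

/-!
# Route `GenusKolyvaginAtTwo`, crux U_T `ShaCardDvdPowAtTwoRT` (stmt-BirchSwinnertonDyer-23658), LINE 19 `rational_pair_descent` v1.1
# (LEAD gk2-p1 g19), stub PAIRCOUNT — item (CTQ): FROM AN EXPONENT AND A `2`-RANK TO THE ORDER
# `2^e · Ш(E/ℚ)[2^∞] = 0` ∧ `#Ш(E/ℚ)[2] ≤ 4` ⟹ `#Ш(E/ℚ)[2^∞] ∣ 4^e` (and the `K`-side twin)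

Seat `bsd-line-gk2-p5` g29 (WIDTH-5 attach, cell `bsd-f1-sign2`), `--supports stmt-BirchSwinnertonDyer-23658` (helper; closes nothing).
THEOREMS ONLY (no definition, no named fact, no `sorry`).  BSD is NOT proved by any of this; neither is U_T, nor PAIRCOUNT.

WHY.  LINE 19 v1.1 proves PAIRCOUNT `#Ш(E/ℚ)[2^∞] ∣ 4^M₀` as (B2Q) SHARP EXPONENT `2^M₀ · Ш(E/ℚ)[2^∞] = 0` + (RANKQ) `dim Ш(E/ℚ)[2] ≤ 2` + (CTQ)
«finite with alternating perfect Cassels–Tate pairing ⟹ `≅ (ℤ/2^t′)²` or `0`, `t′ ≤ M₀`».  This file IS (CTQ), in a form that needs no structure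
theorem: for a finite abelian group `A` killed by `p^e` the filtration `A ⊇ pA ⊇ p²A ⊇ ⋯ ⊇ p^e A = 0` has graded pieces of order `#(p^iA)[p] ≤ #A[p]`,
so **`#A ≤ (#A[p])^e`** (§1); with `#Ш(E/ℚ)[2^∞] = 4^t′` (`…RTShaFiniteAtTwoRat`, Cassels–Tate squareness) and `#Ш(E/ℚ)[2] ≤ 4` this is `t′ ≤ e`.

* §1 `natCard_le_natCard_torsionBy_pow_of_forall_nsmul_eq_zero` (pure; any finite abelian group, any `p`, any subgroup), `natCard_le_natCard_torsionBy_pow`.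
* §2 `pow_dvd_pow_two_mul_of_le` (arithmetic: `4^t ≤ c^e`, `c ≤ 4` ⟹ `4^t ∣ 4^e`).
* §3 over `ℚ` on U_T's frame: **`natCard_primaryComponent_sha_rat_two_dvd_of_exponent_of_card_two_torsion_le_onHabitat`** — `(∀ x ∈ Ш(E/ℚ)[2^∞], 2^e • x = 0)`
  → `#(Ш(E/ℚ)[2^∞])[2] ≤ 4` → `#Ш(E/ℚ)[2^∞] ∣ 2^(2e)`; `…_of_card_sha_two_torsion_le_onHabitat` — the same with the hypothesis on `#Ш(E/ℚ)[2]`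
  (`natCard_sha_torsionBy_pow_eq_primaryComponent`).  With (B2Q) (`e = M₀`) and (RANKQ) this is PAIRCOUNT's conclusion verbatim.
* §4 over `K` (same algebra on `Ш(E/K)[2^∞]`, for the record): `natCard_primaryComponent_sha_two_dvd_of_exponent_of_card_two_torsion_le_onHabitat`.

References: [McCallumLMS1991] §5 Cor. 5.6; [Kolyvagin1989Izv] Thm. B₂; [Fuchs1970] §8 Thm. 8.4, §15; [SilvermanAEC2009] Thm. X.4.14.
-/

set_option autoImplicit false
-- the Theorems namespace of this sub repeats the summit name by design (D-0017 nested layout)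
set_option linter.dupNamespace false

noncomputable section

open scoped Classical
open scoped AddSubgroup

namespace Summit.BirchSwinnertonDyer.BirchSwinnertonDyer.Theorems.GenusExact.PlusDescent

open WeierstrassCurve NumberField IsDedekindDomain Field Literature.NumberTheory.EllipticCurves
  Literature.NumberTheory.GaloisRepresentations Literature.NumberTheory.EllipticCurves.ModularForms AddSubgroup
open Summit.BirchSwinnertonDyer.BirchSwinnertonDyer.Theses.GenusKolyvaginAtTwo (KolyvaginRelationAtTwo)
open Summit.BirchSwinnertonDyer.Rank1Residual

/-! ## §1 `#A ≤ (#A[p])^e` for a finite abelian group killed by `p^e` -/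

section Pure

variable {A : Type*} [AddCommGroup A] [Finite A] (p : ℕ)

/-- **`#B ≤ (#A[p])^e` for every subgroup `B` of a finite abelian group `A` with `p^e · B = 0`.**  Induction on `e` via the multiplication-by-`p`
map `B → A`: its kernel embeds into `A[p]`, its image `pB` is killed by `p^(e−1)`, and `#B = #ker · #pB`. [cite: Fuchs1970, §8 Thm. 8.4 and §15] -/
theorem natCard_le_natCard_torsionBy_pow_of_forall_nsmul_eq_zero :
    ∀ (e : ℕ) (B : AddSubgroup A), (∀ b ∈ B, p ^ e • b = 0) → Nat.card B ≤ Nat.card (A[(p : ℕ)]) ^ e := by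
  intro e
  induction e with
  | zero =>
    intro B hB
    have hbot : B = ⊥ := by
      rw [eq_bot_iff]
      intro b hb
      rw [AddSubgroup.mem_bot]
      simpa using hB b hb
    rw [hbot, AddSubgroup.card_bot, pow_zero]
  | succ e ih =>
    intro B hB
    -- multiplication by `p` on `B`, as a map to `A`
    let f : B →+ A := (nsmulAddMonoidHom (α := A) p).comp B.subtype
    have hf : ∀ b : B, f b = p • (b : A) := fun _ ↦ rfl
    -- its image is killed by `p^e`
    have hrange : ∀ a ∈ f.range, p ^ e • a = 0 := by
      rintro a ⟨b, rfl⟩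
      rw [hf, ← mul_nsmul', ← pow_succ]
      exact hB b b.2
    have hR := ih f.range hrange
    -- its kernel embeds into `A[p]`
    have hK : Nat.card f.ker ≤ Nat.card (A[(p : ℕ)]) := by
      refine Nat.card_le_card_of_injective (fun k : f.ker ↦ (⟨((k : B) : A), AddSubgroup.torsionBy.nsmul_iff.mpr ?_⟩ : A[(p : ℕ)])) ?_
      · have hk := (AddMonoidHom.mem_ker).mp k.2
        rwa [hf] at hk
      · intro k k' h
        have h' : (((k : B)) : A) = ((k' : B) : A) := by simpa using congrArg (fun x : A[(p : ℕ)] ↦ (x : A)) h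
        exact Subtype.ext (Subtype.ext h')
    -- `#B = #ker · #range`
    have hcard : Nat.card B = Nat.card f.range * Nat.card f.ker := by
      rw [AddSubgroup.card_eq_card_quotient_mul_card_addSubgroup f.ker, Nat.card_congr (QuotientAddGroup.quotientKerEquivRange f).toEquiv]
    rw [hcard, pow_succ]
    exact Nat.mul_le_mul hR hK

/-- **`#A ≤ (#A[p])^e`** for a finite abelian group `A` with `p^e · A = 0`. [cite: Fuchs1970, §8 Thm. 8.4 and §15] -/
theorem natCard_le_natCard_torsionBy_pow {e : ℕ} (hA : ∀ a : A, p ^ e • a = 0) : Nat.card A ≤ Nat.card (A[(p : ℕ)]) ^ e := by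
  rw [← AddSubgroup.card_top (G := A)]
  exact natCard_le_natCard_torsionBy_pow_of_forall_nsmul_eq_zero p e ⊤ fun a _ ↦ hA a

end Pure

/-! ## §2 Arithmetic -/

/-- `4^t ≤ c^e` with `c ≤ 4` forces `4^t ∣ 4^e` (`= 2^(2e)`). [folklore] -/
theorem pow_two_mul_dvd_of_le_pow {t e c : ℕ} (hc : c ≤ 4) (h : 2 ^ (2 * t) ≤ c ^ e) : 2 ^ (2 * t) ∣ 2 ^ (2 * e) := by
  have h4 : 2 ^ (2 * t) ≤ 2 ^ (2 * e) := by
    calc 2 ^ (2 * t) ≤ c ^ e := h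
      _ ≤ 4 ^ e := Nat.pow_le_pow_left hc e
      _ = 2 ^ (2 * e) := by rw [pow_mul]; norm_num
  exact Nat.pow_dvd_pow 2 ((Nat.pow_le_pow_iff_right (by norm_num)).mp h4)

/-! ## §3 (CTQ) over `ℚ` on U_T's frame -/

/-- **(CTQ) over `ℚ`: exponent + `2`-rank ⟹ order.**  On U_T's frame: if `2^e` kills `Ш(E/ℚ)[2^∞]` (e.g. (B2Q), `e = M₀`) and `#(Ш(E/ℚ)[2^∞])[2] ≤ 4`
(e.g. (RANKQ), `dim Ш(E/ℚ)[2] ≤ 2`), then `#Ш(E/ℚ)[2^∞] ∣ 2^(2e)` — because `#Ш(E/ℚ)[2^∞] = 4^t′` (`…RTShaFiniteAtTwoRat`: finite + Cassels–Tate squareness)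
and `4^t′ ≤ (#Ш[2])^e ≤ 4^e` (§1).  No structure theorem `Ш ≅ (ℤ/2^t′)²` is needed. [cite: McCallumLMS1991, §5 Cor. 5.6] [cite: Kolyvagin1989Izv, Thm. B₂]
[cite: SilvermanAEC2009, Thm. X.4.14] -/
theorem natCard_primaryComponent_sha_rat_two_dvd_of_exponent_of_card_two_torsion_le_onHabitat (hQ2 : KolyvaginRelationAtTwo)
    (W : WeierstrassCurve ℚ) [W.IsElliptic] [W.IsGloballyMinimal] [NeZero (W.conductorNorm ℤ)] (hcm : ¬ W.HasCM)
    (hT : Odd W.tamagawaProduct) (v : HeightOneSpectrum (𝓞 ℚ)) (h2v : ((2 : ℕ) : 𝓞 ℚ) ∉ v.asIdeal)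
    (hNv : ((W.conductorNorm ℤ : ℕ) : 𝓞 ℚ) ∈ v.asIdeal) (hmult : W.HasMultiplicativeReductionAt v) (hneg : W.Δ < 0)
    (K : Type) [Field K] [NumberField K] (hIQ : IsImaginaryQuadratic K) (hodd : Odd (NumberField.discr K))
    (h3 : NumberField.discr K ≠ -3) (hHe : SatisfiesHeegnerHypothesis (W.conductorNorm ℤ) K)
    (hsq1 : ¬ IsSquare ((NumberField.discr K : ℚ) * -|W.Δ|)) (hsq2 : ¬ IsSquare ((NumberField.discr K : ℚ) * (-(2 * |W.Δ|))))
    (hρ : ∀ n : ℕ, 0 < n → W.HasSurjectiveModNGaloisRep ((2 : ℤ) ^ n))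
    (Dt : ModularParametrizationData W (W.conductorNorm ℤ)) (β : ℤ) (ι : K →+* ℂ) (d₁ : KolyvaginHeegnerData Dt β ι 1) (M₀ : ℕ)
    (hndiv : ¬ ∃ Q : (W.baseChange (ringClassField K ι 1)).toAffine.Point, ((2 ^ (M₀ + 1) : ℕ) : ℤ) • Q = d₁.derivedPoint)
    {e : ℕ} (hexp : ∀ x ∈ AddCommGroup.primaryComponent W.sha 2, 2 ^ e • x = 0)
    (hrk : Nat.card ((AddCommGroup.primaryComponent W.sha 2)[(2 : ℕ)]) ≤ 4) :
    Nat.card (AddCommGroup.primaryComponent W.sha 2) ∣ 2 ^ (2 * e) := by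
  haveI := finite_primaryComponent_sha_rat_two_onHabitat hQ2 W hcm hT v h2v hNv hmult hneg K hIQ hodd h3 hHe hsq1 hsq2 hρ Dt β ι d₁ M₀ hndiv
  obtain ⟨t, ht⟩ := exists_natCard_primaryComponent_sha_rat_two_eq_pow_two_mul_onHabitat hQ2 W hcm hT v h2v hNv hmult hneg K hIQ hodd h3
    hHe hsq1 hsq2 hρ Dt β ι d₁ M₀ hndiv
  have hle := natCard_le_natCard_torsionBy_pow (A := AddCommGroup.primaryComponent W.sha 2) 2
    (fun x ↦ Subtype.ext (by rw [AddSubgroupClass.coe_nsmul, ZeroMemClass.coe_zero]; exact hexp x x.2))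
  rw [ht] at hle ⊢
  exact pow_two_mul_dvd_of_le_pow hrk hle

/-- **(CTQ) over `ℚ`, `Ш(E/ℚ)[2]`-currency**: the same with the `2`-rank hypothesis on `#Ш(E/ℚ)[2]` (`= #(Ш(E/ℚ)[2^∞])[2]`,
`CasselsTateNumberField.natCard_sha_torsionBy_pow_eq_primaryComponent`).  With (B2Q) `e = M₀` and (RANKQ) `#Ш(E/ℚ)[2] ≤ 4` this is PAIRCOUNT's
conclusion `#Ш(E/ℚ)[2^∞] ∣ 4^M₀` verbatim. [cite: McCallumLMS1991, §5 Cor. 5.6] [cite: Kolyvagin1989Izv, Thm. B₂] [cite: SilvermanAEC2009, Thm. X.4.14] -/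
theorem natCard_primaryComponent_sha_rat_two_dvd_of_exponent_of_card_sha_two_torsion_le_onHabitat (hQ2 : KolyvaginRelationAtTwo)
    (W : WeierstrassCurve ℚ) [W.IsElliptic] [W.IsGloballyMinimal] [NeZero (W.conductorNorm ℤ)] (hcm : ¬ W.HasCM)
    (hT : Odd W.tamagawaProduct) (v : HeightOneSpectrum (𝓞 ℚ)) (h2v : ((2 : ℕ) : 𝓞 ℚ) ∉ v.asIdeal)
    (hNv : ((W.conductorNorm ℤ : ℕ) : 𝓞 ℚ) ∈ v.asIdeal) (hmult : W.HasMultiplicativeReductionAt v) (hneg : W.Δ < 0)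
    (K : Type) [Field K] [NumberField K] (hIQ : IsImaginaryQuadratic K) (hodd : Odd (NumberField.discr K))
    (h3 : NumberField.discr K ≠ -3) (hHe : SatisfiesHeegnerHypothesis (W.conductorNorm ℤ) K)
    (hsq1 : ¬ IsSquare ((NumberField.discr K : ℚ) * -|W.Δ|)) (hsq2 : ¬ IsSquare ((NumberField.discr K : ℚ) * (-(2 * |W.Δ|))))
    (hρ : ∀ n : ℕ, 0 < n → W.HasSurjectiveModNGaloisRep ((2 : ℤ) ^ n))
    (Dt : ModularParametrizationData W (W.conductorNorm ℤ)) (β : ℤ) (ι : K →+* ℂ) (d₁ : KolyvaginHeegnerData Dt β ι 1) (M₀ : ℕ)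
    (hndiv : ¬ ∃ Q : (W.baseChange (ringClassField K ι 1)).toAffine.Point, ((2 ^ (M₀ + 1) : ℕ) : ℤ) • Q = d₁.derivedPoint)
    {e : ℕ} (hexp : ∀ x ∈ AddCommGroup.primaryComponent W.sha 2, 2 ^ e • x = 0)
    (hrk : Nat.card (AddSubgroup.torsionBy W.sha ((2 : ℕ) : ℤ)) ≤ 4) :
    Nat.card (AddCommGroup.primaryComponent W.sha 2) ∣ 2 ^ (2 * e) := by
  haveI : Fact (Nat.Prime 2) := ⟨Nat.prime_two⟩
  refine natCard_primaryComponent_sha_rat_two_dvd_of_exponent_of_card_two_torsion_le_onHabitat hQ2 W hcm hT v h2v hNv hmult hneg K hIQ hodd h3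
    hHe hsq1 hsq2 hρ Dt β ι d₁ M₀ hndiv hexp ?_
  have h := CasselsTateNumberField.natCard_sha_torsionBy_pow_eq_primaryComponent W 2 1
  rw [pow_one] at h
  rw [← h]
  exact hrk

/-! ## §4 (CTQ) over `K` on U_T's frame -/

/-- **(CTQ) over `K`** (for the record; same algebra): on U_T's frame, if `2^e` kills `Ш(E/K)[2^∞]` and `#(Ш(E/K)[2^∞])[2] ≤ 4` then
`#Ш(E/K)[2^∞] ∣ 2^(2e)`. [cite: McCallumLMS1991, §5 Cor. 5.6] [cite: SilvermanAEC2009, Thm. X.4.14] -/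
theorem natCard_primaryComponent_sha_two_dvd_of_exponent_of_card_two_torsion_le_onHabitat (hQ2 : KolyvaginRelationAtTwo)
    (W : WeierstrassCurve ℚ) [W.IsElliptic] [W.IsGloballyMinimal] [NeZero (W.conductorNorm ℤ)] (hcm : ¬ W.HasCM)
    (hT : Odd W.tamagawaProduct) (v : HeightOneSpectrum (𝓞 ℚ)) (h2v : ((2 : ℕ) : 𝓞 ℚ) ∉ v.asIdeal)
    (hNv : ((W.conductorNorm ℤ : ℕ) : 𝓞 ℚ) ∈ v.asIdeal) (hmult : W.HasMultiplicativeReductionAt v) (hneg : W.Δ < 0)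
    (K : Type) [Field K] [NumberField K] (hIQ : IsImaginaryQuadratic K) (hodd : Odd (NumberField.discr K))
    (h3 : NumberField.discr K ≠ -3) (hHe : SatisfiesHeegnerHypothesis (W.conductorNorm ℤ) K)
    (hsq1 : ¬ IsSquare ((NumberField.discr K : ℚ) * -|W.Δ|)) (hsq2 : ¬ IsSquare ((NumberField.discr K : ℚ) * (-(2 * |W.Δ|))))
    (hρ : ∀ n : ℕ, 0 < n → W.HasSurjectiveModNGaloisRep ((2 : ℤ) ^ n))
    (Dt : ModularParametrizationData W (W.conductorNorm ℤ)) (β : ℤ) (ι : K →+* ℂ) (d₁ : KolyvaginHeegnerData Dt β ι 1) (M₀ : ℕ)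
    (hndiv : ¬ ∃ Q : (W.baseChange (ringClassField K ι 1)).toAffine.Point, ((2 ^ (M₀ + 1) : ℕ) : ℤ) • Q = d₁.derivedPoint)
    {e : ℕ} (hexp : ∀ x ∈ AddCommGroup.primaryComponent (W.baseChange K).sha 2, 2 ^ e • x = 0)
    (hrk : Nat.card ((AddCommGroup.primaryComponent (W.baseChange K).sha 2)[(2 : ℕ)]) ≤ 4) :
    Nat.card (AddCommGroup.primaryComponent (W.baseChange K).sha 2) ∣ 2 ^ (2 * e) := by
  haveI := finite_primaryComponent_sha_two_onHabitat hQ2 W hcm hT v h2v hNv hmult hneg K hIQ hodd h3 hHe hsq1 hsq2 hρ Dt β ι d₁ M₀ hndiv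
  obtain ⟨t, ht⟩ := exists_natCard_primaryComponent_sha_two_eq_pow_two_mul_onHabitat hQ2 W hcm hT v h2v hNv hmult hneg K hIQ hodd h3
    hHe hsq1 hsq2 hρ Dt β ι d₁ M₀ hndiv
  have hle := natCard_le_natCard_torsionBy_pow (A := AddCommGroup.primaryComponent (W.baseChange K).sha 2) 2
    (fun x ↦ Subtype.ext (by rw [AddSubgroupClass.coe_nsmul, ZeroMemClass.coe_zero]; exact hexp x x.2))
  rw [ht] at hle ⊢
  exact pow_two_mul_dvd_of_le_pow hrk hle

end Summit.BirchSwinnertonDyer.BirchSwinnertonDyer.Theorems.GenusExact.PlusDescent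

end
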